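import Mathlib
import HarnessLib
import Literature.Analysis.FluidPDE.KNSSSwirlSupNonpos
import Summits.NavierStokesRegularity.NavierStokesRegularity.Theorems.HalfSpaceWindowDoorCirculationCarryingRigiditySubSwirlIntegrable

/-!
# Route `HalfSpaceWindowDoor`, crux `CirculationCarryingRigidity` (stmt-NavierStokesRegularity-25311) — the ONE-SIDED
# eddy-torque engine, part 3c: the tested SPACE–TIME INEQUALITY

Line `eddy_torque` (LEAD ns-hsw-p1 g5).  For a swirl SUBSOLUTION pair (`…Defs.IsSubSwirl`) on `(−∞, τ')` and the KNSS cut-off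
`φ = φ_{L,T}`, `0 ≤ T < τ'`: the four KNSS integrands `(F−M)∂ₛφ`, `(F−M)(Dφ[V]+Δφ)`, `(2/r)FDφ[e_r]`, `G₀φ` and the one-sided
source integrand `(A/√(τ'−s))∂ᵣF φ` are absolutely convergent on `(0,T] × ℝ³` (`spaceTime_integrable`, verbatim from g3;
`spaceTime_integrable_source`), and Fubini + the time inequality (`…SubSwirlSpaceTime.time_inequality`, a.e. line off the axis) + the
slice identity give the SPACE–TIME INEQUALITY (KNSS (5.15) = (5.17) + (5.19) for subsolutions)

  `0 ≤ ∫∫ (F − M)∂ₛφ + ∫ₛ [ ∫(F − M)(Dφ[V] + Δφ) + ∫(2/r) F φ_{,r} + ∫ (A/√(τ'−s)) ∂ᵣF φ ]`   (`spaceTime_inequality`),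

which replaces g3's `spaceTime_identity` (`… − ∫B∂ᵣFφ = 0`) in the Liouville argument: the source term now enters with a SIGN
and only needs an upper bound.

Seat ns-hsw-p1 g5 (LEAD of 25311, cell pub-ns-dss).  WHAT THIS IS NOT: not a statement about Navier–Stokes regularity (Clay A); a
linear parabolic tool about HYPOTHETICAL blow-up profiles; helper `--supports` 25311.
-/

noncomputable section

-- the summit and its single sub-problem share the name (CONVENTIONS §1), as in every Theorems file
set_option linter.dupNamespace false

namespace Summit.NavierStokesRegularity.NavierStokesRegularity.Theorems.HalfSpaceWindowDoorCirculationCarryingRigiditySubSwirlIdentity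

open MeasureTheory Set Function Filter Topology TopologicalSpace InnerProductSpace WithLp Metric
open scoped Laplacian RealInnerProductSpace ContDiff
open Literature.Analysis Literature.Analysis.FluidPDE
open Summit.NavierStokesRegularity.NavierStokesRegularity.Theorems.HalfSpaceWindowDoorCirculationCarryingRigidityDefs
open Summit.NavierStokesRegularity.NavierStokesRegularity.Theorems.HalfSpaceWindowDoorCirculationCarryingRigiditySubSwirl
open Summit.NavierStokesRegularity.NavierStokesRegularity.Theorems.HalfSpaceWindowDoorCirculationCarryingRigiditySubSwirl.IsSubSwirl
open Summit.NavierStokesRegularity.NavierStokesRegularity.Theorems.HalfSpaceWindowDoorCirculationCarryingRigiditySubSwirlSpaceTime.IsSubSwirl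
open Summit.NavierStokesRegularity.NavierStokesRegularity.Theorems.HalfSpaceWindowDoorCirculationCarryingRigiditySubSwirlIntegrable.IsSubSwirl

namespace IsSubSwirl

variable {Cf Cu Cg A τ' : ℝ} {F : ℝ → (EuclideanSpace ℝ (Fin 3)) → ℝ}
  {V : ℝ → (EuclideanSpace ℝ (Fin 3)) → (EuclideanSpace ℝ (Fin 3))}

/-- **THE SPACE–TIME INEQUALITY** (KNSS (5.15) = (5.17) + (5.19) for a swirl SUBSOLUTION pair; replaces g3's
`spaceTime_identity`): for `0 ≤ T < τ'`, a constant `M` and the cut-off `φ = φ_{L,T}`, the inner space integrals of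
`(F − M) ∂ₛφ`, `(F − M)(Dφ[V] + Δφ)`, `(2/r) F Dφ[e_r]`, `(A/√(τ'−s)) ∂ᵣF φ` are integrable in time over `(0, T]` and
`0 ≤ ∫∫ (F − M)∂ₛφ + ∫ₛ [∫(F − M)(Dφ[V] + Δφ) + ∫(2/r) F φ_{,r} + ∫ (A/√(τ'−s)) ∂ᵣF φ]`. -/
theorem spaceTime_inequality (hP : IsSubSwirl Cf Cu Cg A τ' F V) {L T : ℝ}
    (hT0 : 0 ≤ T) (hTτ : T < τ') (M : ℝ) :
    Integrable (fun s => ∫ y, (F s y - M) * (psiCut L y * deriv (zetaCut T) s))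
      (volume.restrict (Ioc 0 T)) ∧
    Integrable (fun s => ∫ y, (F s y - M) *
      (fderiv ℝ (phiCut L T s) y (V s y) + (Δ (phiCut L T s)) y)) (volume.restrict (Ioc 0 T)) ∧
    Integrable (fun s => ∫ y, 2 / cylRadius y * (F s y * fderiv ℝ (phiCut L T s) y (eR y)))
      (volume.restrict (Ioc 0 T)) ∧
    Integrable (fun s => ∫ y, A / Real.sqrt (τ' - s) * fderiv ℝ (F s) y (eR y) * phiCut L T s y)
      (volume.restrict (Ioc 0 T)) ∧
    0 ≤ (∫ s in Ioc 0 T, ∫ y, (F s y - M) * (psiCut L y * deriv (zetaCut T) s)) +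
      ∫ s in Ioc 0 T, ((∫ y, (F s y - M) *
        (fderiv ℝ (phiCut L T s) y (V s y) + (Δ (phiCut L T s)) y)) +
        (∫ y, 2 / cylRadius y * (F s y * fderiv ℝ (phiCut L T s) y (eR y))) +
        ∫ y, A / Real.sqrt (τ' - s) * fderiv ℝ (F s) y (eR y) * phiCut L T s y) := by
  have hτ : ∀ s ∈ Ioc (0 : ℝ) T, s < τ' := fun s hs => lt_of_le_of_lt hs.2 hTτ
  obtain ⟨hint1, hint2, hint3, hint40⟩ := spaceTime_integrable hP (L := L) hTτ M
  have hint5 := spaceTime_integrable_source hP (L := L) hTτ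
  have hint4 : Integrable (fun p : ℝ × (EuclideanSpace ℝ (Fin 3)) =>
      (swirlEqnIntegrand F V p.1 p.2 + A / Real.sqrt (τ' - p.1) * fderiv ℝ (F p.1) p.2 (eR p.2)) *
        phiCut L T p.1 p.2) ((volume.restrict (Ioc 0 T)).prod volume) := by
    refine (hint40.add hint5).congr (Eventually.of_forall fun p => ?_)
    simp only [Pi.add_apply]; ring
  refine ⟨hint1.integral_prod_left, hint2.integral_prod_left, hint3.integral_prod_left,
    hint5.integral_prod_left, ?_⟩
  -- Fubini for the time term, and the time inequality on a.e. line
  have e1 : ∫ s in Ioc 0 T, ∫ y, (F s y - M) * (psiCut L y * deriv (zetaCut T) s) =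
      ∫ y, ∫ s in Ioc 0 T, (F s y - M) * (psiCut L y * deriv (zetaCut T) s) :=
    integral_integral_swap (f := fun s y => (F s y - M) * (psiCut L y * deriv (zetaCut T) s)) hint1
  have e2 : ∀ᵐ y ∂(volume : Measure (EuclideanSpace ℝ (Fin 3))),
      -∫ s in Ioc 0 T, (swirlEqnIntegrand F V s y + A / Real.sqrt (τ' - s) * fderiv ℝ (F s) y (eR y)) *
          phiCut L T s y ≤
        ∫ s in Ioc 0 T, (F s y - M) * (psiCut L y * deriv (zetaCut T) s) := by
    filter_upwards [ae_cylRadius_ne_zero] with y hy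
    rw [← intervalIntegral.integral_of_le hT0, ← intervalIntegral.integral_of_le hT0]
    exact time_inequality hP hT0 hTτ M hy
  have hI1y : Integrable (fun y => ∫ s in Ioc 0 T, (F s y - M) * (psiCut L y * deriv (zetaCut T) s)) volume :=
    hint1.integral_prod_right
  have hI4y : Integrable (fun y => -∫ s in Ioc 0 T, (swirlEqnIntegrand F V s y +
      A / Real.sqrt (τ' - s) * fderiv ℝ (F s) y (eR y)) * phiCut L T s y) volume :=
    hint4.integral_prod_right.neg
  have hmono := integral_mono_ae hI4y hI1y e2
  rw [integral_neg] at hmono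
  have e3 : ∫ s in Ioc 0 T, ∫ y, (swirlEqnIntegrand F V s y + A / Real.sqrt (τ' - s) * fderiv ℝ (F s) y (eR y)) *
      phiCut L T s y =
      ∫ y, ∫ s in Ioc 0 T, (swirlEqnIntegrand F V s y + A / Real.sqrt (τ' - s) * fderiv ℝ (F s) y (eR y)) *
        phiCut L T s y :=
    integral_integral_swap (f := fun s y =>
      (swirlEqnIntegrand F V s y + A / Real.sqrt (τ' - s) * fderiv ℝ (F s) y (eR y)) * phiCut L T s y) hint4
  have e4 : ∫ s in Ioc 0 T, ∫ y, (swirlEqnIntegrand F V s y + A / Real.sqrt (τ' - s) * fderiv ℝ (F s) y (eR y)) *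
      phiCut L T s y =
      ∫ s in Ioc 0 T, ((∫ y, (F s y - M) *
        (fderiv ℝ (phiCut L T s) y (V s y) + (Δ (phiCut L T s)) y)) +
        (∫ y, 2 / cylRadius y * (F s y * fderiv ℝ (phiCut L T s) y (eR y))) +
        ∫ y, A / Real.sqrt (τ' - s) * fderiv ℝ (F s) y (eR y) * phiCut L T s y) := by
    refine setIntegral_congr_fun measurableSet_Ioc fun s hs => ?_
    have h := slice_identity hP (hτ s hs) L T M
    obtain ⟨-, -, -, hsplit⟩ := integral_source_slice hP (hτ s hs) L T
    simp only [swirlEqnIntegrand] at h hsplit ⊢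
    rw [hsplit, ← h]
  rw [← e4, e1, e3]
  linarith [hmono]

end IsSubSwirl

end Summit.NavierStokesRegularity.NavierStokesRegularity.Theorems.HalfSpaceWindowDoorCirculationCarryingRigiditySubSwirlIdentity

end
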